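import Summits.ResolutionOfSingularities.ResolutionOfSingularities.Theorems.PurelyInseparableDim4ResConeCInfFrameEntry
import Summits.ResolutionOfSingularities.ResolutionOfSingularities.Theorems.PurelyInseparableDim4ResConeCInfPinning
import Summits.ResolutionOfSingularities.ResolutionOfSingularities.Theorems.PurelyInseparableDim4SwapTransport
import HarnessLib
import HarnessLib.Audit.Tags

/-!
# Purely inseparable four-folds — THE C∞ VIRTUAL ENTRY (K24b-R1 (E0)): at ONE real slot step, a framed VIRTUAL state with
# an explicit slot-unit-class relation to the real child — no tail hypothesis, rotations elsewhere allowed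
# (cell `res-dim4-pi`, K2(p) lane, slice B; C∞ assembly K24c L2b / K24b-R1 entry)

[OURS · counted 0 · cell `res-dim4-pi` · K2(p) lane; res-dim4-typ-1 g3's K24b-R1 virtual window
(`SwapTransport.virtual_window_false_of_entry`, HOME `lean-g3/SwapTransportWindowIter.lean`) asked for its ENTRY (bus
2026-08-29 05:45:01Z «(E0) YES PLEASE»); seat res-dim4-p-3 g4.]  Nothing here proves K2(p)/K2(5), `NoIsolatedTrap 5 5` or
resolution of singularities in dimension ≥ 4 / characteristic `p` — NOT proved.  AI kernel work, weaker than expert review.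

**`exists_cInf_virtual_entry`.**  INPUT (two real states, no chain): a real SLOT step `A = step 5 univ κ β A′` in the C∞
regime — `κ ∈ {λ, μ}`, `β` vanishing on `κ, λ, μ`, both states of order `6` with ledger `x_λ x_μ ∣ F`, `A′` clean with a
power cone `a₀·ℓ⁴` charging the free letter `f` (`ℓ_f ≠ 0`) and the EXACT PAIR LEDGER in ideal form
`U·G′ = S·x_λx_μ + T·ℓ⁴` (K11-lin `stretch_pair_ledger_linear` on the chain), `A` isolated with `e_G = 3`.  OUTPUT: a virtual
state `B₀` and a substitution `θ` with `θ λ = x_λ`, `θ μ = x_μ`, `θ u (0) = θ f (0) = 0`, free tangent block of determinant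
`≠ 0`, **`B₀.F = clean (aeval θ A.F)`** (the relation `hrel0` of the virtual window with `π₀ = id`, `U = 1`, `E = 0`), and the
FRAME of `B₀` (`hfr0`): order `6`, `r = x_λ x_μ ∣ F`, straight `resForm = a·x_f⁴`, exact pair-ledger support form, dead
`ū²`-row below ANY prescribed degree `N`, `V(0) ≠ 0`, isolated, `e_G = 3`.  **`exists_cInf_virtual_entry_rel`** = the
same in the window's own currency `∀ M N, ∃ B₀, (∃ θ e U E, …ℛ²-relation…) ∧ frame at jet N` (typ-1's `hE` conjuncts with
`π₀ = id`).  The two states `A′, A` are ARBITRARY states joined by a slot step (`A′` need not be a chain state and `β_u`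
is free), so a real ROTATION step re-presented as a virtual slot step from the same parent (typ-1's
`unitFrame_rotate₂` with `θ = X`, `U = 1`, `E = 0`) is served by the same theorem once the child-side readings
(order, ledger, isolation, `e_G`) are transported to the virtual child.
ROUTE = `…CInfFrameEntry` at the STATE level: p-11's `FrameChange.step_cleanTsch` (clean re-framing commutes with the point
step) replaces the chain transport; the `f`-straightening `φ_ℓ` and the linear `u`-translation killer `(β u)·x_κ` make the
step PURE CORNER in the frame ((VT-f) = typ-1 g2's state-level `cInf_translation_contact_eq_zero_of_le`), so
`…CInfFrameTools.cInf_entry_of_corner` carries straightness / exact ledger / `V(0) ≠ 0` to the framed child; typ-1 g3's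
(E-u) `exists_second_tschirnhaus` gives `ψ`; `θ = tsch u ψ ∘ tsch f φ_ℓ⁺` and p-7/typ-1's
`deletePthPowers_aeval_deletePthPowers` (cleaning commutes with substitutions in characteristic `p`) give the relation.

[cite: CossartJannsenSaito2020, Thm. 3.14, Lemma 13.2] [cite: Hauser2010, §§F–G] [cite: Kollar2007, Aside 3.57]
bears_on: LADDER-RESOLUTION:D157-DOOR2 (res-dim4-pi · K2(p) slice B · K24b-R1 entry (E0)).
Supports stmt-ResolutionOfSingularities-16155 (helper).
-/

set_option linter.dupNamespace false -- mandated namespace of this single-conjunct summit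

noncomputable section

namespace Summit.ResolutionOfSingularities.ResolutionOfSingularities.Theorems.PIDim4

namespace ResCone

open MvPolynomial Finset FrameChange
open Literature.AlgebraicGeometry.Resolution
open Literature.AlgebraicGeometry.Resolution.CentreBlowup
open Literature.AlgebraicGeometry.Resolution.Hauser2010
open Literature.AlgebraicGeometry.Resolution.HauserPerlega2019
open PointBlowup (translate)

variable {K : Type} [Field K]

/-- The step does not read the bookkeeping set `exc` in its `F` and `r` components. [folklore] -/
theorem step_F_r_of_exc [DecidableEq K] (q : ℕ) (j : Fin 4) (b : Fin 4 → K) (s : State K) (E : Finset (Fin 4)) :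
    (CentreBlowup.step q Finset.univ j b (⟨s.F, s.r, E⟩ : State K)).F = (CentreBlowup.step q Finset.univ j b s).F ∧
      (CentreBlowup.step q Finset.univ j b (⟨s.F, s.r, E⟩ : State K)).r = (CentreBlowup.step q Finset.univ j b s).r :=
  ⟨rfl, rfl⟩

/-- `translate b (C c) − C (eval b (C c)) = 0`: a constant datum shifts to nothing. [folklore] -/
theorem tschShift_C [DecidableEq K] (b : Fin 4 → K) (c : K) :
    translate b (C c : MvPolynomial (Fin 4) K) - C (MvPolynomial.eval b (C c : MvPolynomial (Fin 4) K)) = 0 := by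
  unfold PointBlowup.translate
  rw [aeval_C, MvPolynomial.algebraMap_eq, eval_C, sub_self]

section Entry

variable [CharP K 5] [DecidableEq K]

/-- **THE C∞ VIRTUAL ENTRY** (statement and route in the module docstring). [OURS]
[cite: CossartJannsenSaito2020, Thm. 3.14, Lemma 13.2] -/
theorem exists_cInf_virtual_entry {la mu u f : Fin 4} (hlm : la ≠ mu) (hlu : la ≠ u) (hlf : la ≠ f) (hmu : mu ≠ u)
    (hmf : mu ≠ f) (huf : u ≠ f) {κ : Fin 4} (hκ : κ = la ∨ κ = mu) {A' A : State K} {β : Fin 4 → K}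
    (hβκ : β κ = 0) (hβla : β la = 0) (hβmu : β mu = 0) (hA : A = CentreBlowup.step 5 Finset.univ κ β A')
    (hrA' : A'.r = Finsupp.single la 1 + Finsupp.single mu 1) (hrA : A.r = Finsupp.single la 1 + Finsupp.single mu 1)
    (hdivA' : ∀ e ∈ A'.F.support, A'.r ≤ e) (hdivA : ∀ e ∈ A.F.support, A.r ≤ e) (hoA' : ordZero A'.F = (6 : ℕ))
    (hoA : ordZero A.F = (6 : ℕ)) (hcleanA' : deletePthPowers 5 A'.F = A'.F) (hisoA : IsIsolated 5 A.F)
    (he3A : Module.finrank K (resVertex A) = 3) {ℓ : Fin 4 → K} {a0 : K}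
    (hform' : resForm A' = C a0 * (∑ i, C (ℓ i) * X i) ^ 4) (hℓf : ℓ f ≠ 0) {U S T : MvPolynomial (Fin 4) K}
    (hU : MvPolynomial.eval (0 : Fin 4 → K) U ≠ 0)
    (hledger : U * (A'.F.divMonomial A'.r) = S * (X la * X mu) + T * (∑ i, C (ℓ i) * X i) ^ 4) (N : ℕ) :
    ∃ (B : State K) (θ : Fin 4 → MvPolynomial (Fin 4) K),
      θ la = X la ∧ θ mu = X mu ∧ constantCoeff (θ u) = 0 ∧ constantCoeff (θ f) = 0 ∧
      coeff (Finsupp.single u 1) (θ u) * coeff (Finsupp.single f 1) (θ f) -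
        coeff (Finsupp.single f 1) (θ u) * coeff (Finsupp.single u 1) (θ f) ≠ 0 ∧
      B.F = deletePthPowers 5 (aeval θ A.F) ∧
      ordZero B.F = (6 : ℕ) ∧ B.r = Finsupp.single la 1 + Finsupp.single mu 1 ∧ (∀ d ∈ B.F.support, B.r ≤ d) ∧
      (∃ a : K, a ≠ 0 ∧ resForm B = C a * X f ^ 4) ∧
      (∀ e ∈ B.F.support, e f ≤ 3 → 2 ≤ e la ∧ 2 ≤ e mu) ∧
      (∀ d ∈ B.F.support, d.degree < N → ¬ (d u = 2 ∧ d f = 0)) ∧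
      coeff (B.r + (Finsupp.single la 1 + Finsupp.single mu 1 + Finsupp.single u 3)) B.F ≠ 0 ∧
      IsIsolated 5 B.F ∧ Module.finrank K (resVertex B) = 3 := by
  haveI : Fact (Nat.Prime 5) := ⟨by norm_num⟩
  -- (0) letters and basic facts
  have hκf : κ ≠ f := by rcases hκ with rfl | rfl <;> assumption
  have hκu : κ ≠ u := by rcases hκ with rfl | rfl <;> assumption
  have hrf' : A'.r f = 0 := by
    rw [hrA', Finsupp.add_apply, Finsupp.single_eq_of_ne hlf.symm, Finsupp.single_eq_of_ne hmf.symm, add_zero]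
  have hru' : A'.r u = 0 := by
    rw [hrA', Finsupp.add_apply, Finsupp.single_eq_of_ne hlu.symm, Finsupp.single_eq_of_ne hmu.symm, add_zero]
  have hrfA : A.r f = 0 := by
    rw [hrA, Finsupp.add_apply, Finsupp.single_eq_of_ne hlf.symm, Finsupp.single_eq_of_ne hmf.symm, add_zero]
  have hruA : A.r u = 0 := by
    rw [hrA, Finsupp.add_apply, Finsupp.single_eq_of_ne hlu.symm, Finsupp.single_eq_of_ne hmu.symm, add_zero]
  have hq' : ((5 : ℕ) : ℕ∞) ≤ ordZero A'.F := by rw [hoA']; exact_mod_cast (by norm_num : 5 ≤ 6)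
  have h56 : ¬ 5 ∣ 6 := by decide
  have hAclean : deletePthPowers 5 A.F = A.F := by rw [hA]; exact deletePthPowers_step_F 5 Finset.univ κ β A'
  have hAval : MvPolynomial.eval (0 : Fin 4 → K) U ≠ 0 := hU
  have hA0 : a0 * ℓ f ^ 4 ≠ 0 := straighten_coeff_ne_zero (ne_zero_of_resForm_eq_C_mul hoA' hdivA' hform') hℓf 4
  -- the exc-free copy of the parent
  set A'ₑ : State K := ⟨A'.F, A'.r, ∅⟩ with hA'ₑ
  have hAₑ : (CentreBlowup.step 5 Finset.univ κ β A'ₑ).F = A.F ∧ (CentreBlowup.step 5 Finset.univ κ β A'ₑ).r = A.r := by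
    rw [hA]; exact step_F_r_of_exc 5 κ β A' ∅
  -- (1) the data: straightening at `f`, translation killer at `u`
  obtain ⟨hΦvars, hΦ0, -⟩ := straighten_datum_admissible (K := K) (f := f) ℓ
  set Φ : MvPolynomial (Fin 4) K := ∑ i, C ((fun i => if i = f then (0 : K) else -(ℓ i / ℓ f)) i) * X i with hΦ
  set Φ' : MvPolynomial (Fin 4) K := chartTransform 1 Finset.univ κ Φ with hΦ'
  set b₁ : Fin 4 → K := Function.update β f (β f - MvPolynomial.eval β Φ') with hb₁
  set Φp : MvPolynomial (Fin 4) K := translate b₁ Φ' - C (MvPolynomial.eval b₁ Φ') with hΦp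
  have hΦpvars : f ∉ Φp.vars := not_mem_vars_tschShift (not_mem_vars_chartTransform 1 Finset.univ hκf hΦvars) b₁
  have hΦp0 : constantCoeff Φp = 0 := constantCoeff_tschShift b₁ Φ'
  have hev : MvPolynomial.eval b₁ Φ' = MvPolynomial.eval β Φ' :=
    eval_update_of_not_mem_vars (not_mem_vars_chartTransform 1 Finset.univ hκf hΦvars) β _
  have hb₁' : Function.update b₁ f (b₁ f + MvPolynomial.eval b₁ Φ') = β := by
    rw [hev, hb₁, Function.update_idem, Function.update_apply, if_pos rfl, sub_add_cancel, Function.update_eq_self]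
  -- S₁ := the straightened parent; its step at `b₁` is the straightened child
  set S₁ : State K := ⟨deletePthPowers 5 (tsch f Φ A'.F), A'.r, ∅⟩ with hS₁
  have hstep₁ : CentreBlowup.step 5 Finset.univ κ b₁ S₁ =
      ⟨deletePthPowers 5 (tsch f Φp A.F), A.r, (CentreBlowup.step 5 Finset.univ κ β A'ₑ).exc⟩ := by
    have h := step_cleanTsch 5 (s := A'ₑ) hq' hcleanA' hκf hΦvars hΦ0 hrf' (Finset.notMem_empty f) b₁
    rw [hb₁'] at h
    rw [hS₁, h, hAₑ.1, hAₑ.2]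
  have hS₁clean : deletePthPowers 5 S₁.F = S₁.F := PointBlowup.deletePthPowers_deletePthPowers 5 _
  have hoS₁ : ordZero S₁.F = ((6 : ℕ) : ℕ∞) := by rw [hS₁]; exact (ordZero_clean_tsch 5 hΦvars hΦ0 hcleanA').trans hoA'
  have hqS₁ : ((5 : ℕ) : ℕ∞) ≤ ordZero S₁.F := by rw [hoS₁]; exact_mod_cast (by norm_num : 5 ≤ 6)
  have hdivS₁ : ∀ e ∈ S₁.F.support, S₁.r ≤ e := forall_le_of_mem_support_clean_tsch 5 hrf' hdivA'
  have hruS₁ : S₁.r u = 0 := hru'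
  have hresS₁ : resForm S₁ = C (a0 * ℓ f ^ 4) * X f ^ 4 :=
    resForm_cleanTschState_straighten 5 hoA' h56 hrf' hdivA' hform' hℓf
  -- (2) the translation killer at `u`
  obtain ⟨hψ₀vars, hψ₀0⟩ := linear_datum_admissible (K := K) hκu (β u)
  have hψ₀hom : (C (β u) * X κ : MvPolynomial (Fin 4) K).IsHomogeneous 1 := isHomogeneous_C_mul_X _ _
  set b₂ : Fin 4 → K := Function.update b₁ u 0 with hb₂
  have hb₁u : b₁ u = β u := by rw [hb₁, Function.update_of_ne huf]
  have hb₂' : Function.update b₂ u (b₂ u + MvPolynomial.eval b₂ (chartTransform 1 Finset.univ κ (C (β u) * X κ))) = b₁ := by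
    rw [eval_chartTransform_one_C_mul_X, hb₂, Function.update_idem, Function.update_apply, if_pos rfl, zero_add, ← hb₁u,
      Function.update_eq_self]
  set S₂ : State K := ⟨deletePthPowers 5 (tsch u (C (β u) * X κ) S₁.F), S₁.r, S₁.exc⟩ with hS₂
  have hstep₂ : CentreBlowup.step 5 Finset.univ κ b₂ S₂ =
      ⟨deletePthPowers 5 (tsch f Φp A.F), A.r, (CentreBlowup.step 5 Finset.univ κ b₁ S₁).exc⟩ := by
    have h := step_cleanTsch 5 (s := S₁) hqS₁ hS₁clean hκu hψ₀vars hψ₀0 hru' (Finset.notMem_empty u) b₂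
    rw [hb₂'] at h
    rw [hS₂, h, hstep₁]
    have hshift : translate b₂ (chartTransform 1 Finset.univ κ (C (β u) * X κ : MvPolynomial (Fin 4) K)) -
        C (MvPolynomial.eval b₂ (chartTransform 1 Finset.univ κ (C (β u) * X κ : MvPolynomial (Fin 4) K))) = 0 := by
      rw [chartTransform_C_mul, chartTransform_one_X, if_pos rfl, mul_one]
      exact tschShift_C b₂ (β u)
    rw [hshift, tsch_zero, AlgHom.id_apply, PointBlowup.deletePthPowers_deletePthPowers]
  have hoS₂ : ordZero S₂.F = ((6 : ℕ) : ℕ∞) := by rw [hS₂]; exact (ordZero_clean_tsch 5 hψ₀vars hψ₀0 hS₁clean).trans hoS₁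
  have hdivS₂ : ∀ e ∈ S₂.F.support, S₂.r ≤ e := forall_le_of_mem_support_clean_tsch 5 hru' hdivS₁
  have hrS₂ : S₂.r = Finsupp.single la 1 + Finsupp.single mu 1 := hrA'
  have hresS₂ : resForm S₂ = C (a0 * ℓ f ^ 4) * X f ^ 4 := by
    rw [hS₂, resForm_cleanTschState_eq 5 hψ₀vars hψ₀0 hoS₁ h56,
      resForm_tschState_of_isHomogeneous_one hψ₀vars hψ₀hom hruS₁ hdivS₁, hresS₁, map_mul, FrameChange.tsch_C, map_pow,
      tsch_X_of_ne _ huf.symm]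
  -- (3) the step from `S₂` is a PURE CORNER step
  have hoC : ordZero (CentreBlowup.step 5 Finset.univ κ b₂ S₂).F = ((6 : ℕ) : ℕ∞) := by
    rw [hstep₂]; exact (ordZero_clean_tsch 5 hΦpvars hΦp0 hAclean).trans hoA
  have hb₂0 : b₂ = 0 := by
    have hb₂κ : b₂ κ = 0 := by rw [hb₂, Function.update_of_ne hκu, hb₁, Function.update_of_ne hκf]; exact hβκ
    have hb₂la : b₂ la = 0 := by rw [hb₂, Function.update_of_ne hlu, hb₁, Function.update_of_ne hlf]; exact hβla
    have hb₂mu : b₂ mu = 0 := by rw [hb₂, Function.update_of_ne hmu, hb₁, Function.update_of_ne hmf]; exact hβmu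
    have hb₂u : b₂ u = 0 := by rw [hb₂, Function.update_apply, if_pos rfl]
    -- (VT-f): the contact letter is not translated
    have hb₂f : b₂ f = 0 := by
      rcases hκ with hκl | hκm
      · subst hκl
        refine cInf_translation_contact_eq_zero_of_le (Ne.symm hlm) hlf.symm hmf.symm (s := S₂) (by rw [hoS₂]; rfl) hA0
          ?_ hb₂la hb₂mu (by rw [hoC]; exact_mod_cast (by norm_num : 3 ≤ 6))
        rw [← monomial_mul_resForm hdivS₂, hresS₂, hrS₂, X_pow_eq_monomial, C_mul_monomial, mul_one, monomial_mul,
          one_mul]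
      · subst hκm
        have hrS₂' : S₂.r = Finsupp.single κ 1 + Finsupp.single la 1 := by rw [hrS₂, add_comm]
        refine cInf_translation_contact_eq_zero_of_le hlm hmf.symm hlf.symm (s := S₂) (by rw [hoS₂]; rfl) hA0
          ?_ hb₂mu hb₂la (by rw [hoC]; exact_mod_cast (by norm_num : 3 ≤ 6))
        rw [← monomial_mul_resForm hdivS₂, hresS₂, hrS₂', X_pow_eq_monomial, C_mul_monomial, mul_one, monomial_mul,
          one_mul]
    funext i
    rcases letters_exhaust hlm hlu hlf hmu hmf huf i with h | h | h | h <;> rw [h, Pi.zero_apply]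
    · exact hb₂la
    · exact hb₂mu
    · exact hb₂u
    · exact hb₂f
  rw [hb₂0] at hstep₂ hoC
  -- (4) the framed child `C₁` and the entry of the pure corner step
  set C₁ : State K := CentreBlowup.step 5 Finset.univ κ 0 S₂ with hC₁
  have hC₁F : C₁.F = deletePthPowers 5 (tsch f Φp A.F) := by rw [hstep₂]
  have hrC₁ : C₁.r = Finsupp.single la 1 + Finsupp.single mu 1 := by rw [hstep₂]; exact hrA
  have hdivC₁ : ∀ e ∈ C₁.F.support, C₁.r ≤ e := by
    rw [hstep₂]; exact forall_le_of_mem_support_clean_tsch 5 hrfA hdivA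
  have hisoC₁ : IsIsolated 5 C₁.F := by rw [hC₁F]; exact (isIsolated_clean_tsch_iff 5 hΦpvars hΦp0 _).mpr hisoA
  have he3C₁ : Module.finrank K (resVertex C₁) = 3 := by
    rw [hstep₂]
    exact (finrank_resVertex_cleanTschState 5 hΦpvars hΦp0 hrfA hdivA hoA h56).trans he3A
  have hoC₁ : ordZero C₁.F = (6 : ℕ) := hoC
  have hledS₂ : ∀ e ∈ S₂.F.support, e f ≤ 3 → 2 ≤ e la ∧ 2 ≤ e mu := by
    intro e he hef
    have h := lowLedger_frame_of_pair_ledger_linear 5 hlu.symm hmu.symm huf hlf hmf (C (β u) * X κ) hΦ0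
      (tsch_linearForm_straighten hℓf) hrf' (monomial_mul_divMonomial hdivA').symm hAval hledger e he (by omega)
    rw [hrA'] at h
    simp only [Finsupp.add_apply, Finsupp.single_eq_same, Finsupp.single_eq_of_ne hlm,
      Finsupp.single_eq_of_ne (Ne.symm hlm), add_zero, zero_add] at h
    obtain ⟨h1, h2⟩ := h
    exact ⟨by omega, by omega⟩
  have hentry : resForm C₁ = C (a0 * ℓ f ^ 4) * X f ^ 4 ∧
      (∀ e ∈ C₁.F.support, e f ≤ 3 → 2 ≤ e la ∧ 2 ≤ e mu) ∧
      coeff (C₁.r + (Finsupp.single la 1 + Finsupp.single mu 1 + Finsupp.single u 3)) C₁.F ≠ 0 := by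
    rcases hκ with hκl | hκm
    · subst hκl
      obtain ⟨h1, h2, -, h4⟩ := cInf_entry_of_corner hlm hlu hlf hmu hmf huf hrS₂ hdivS₂ (by rw [hoS₂]) hA0 hresS₂
        hledS₂ hisoC₁ (by rw [hoC₁]) he3C₁ hrC₁ hdivC₁
      exact ⟨h1, h2, h4⟩
    · subst hκm
      have hrS₂' : S₂.r = Finsupp.single κ 1 + Finsupp.single la 1 := by rw [hrS₂, add_comm]
      have hrC₁' : C₁.r = Finsupp.single κ 1 + Finsupp.single la 1 := by rw [hrC₁, add_comm]
      obtain ⟨h1, h2, -, h4⟩ := cInf_entry_of_corner (Ne.symm hlm) hmu hmf hlu hlf huf hrS₂' hdivS₂ (by rw [hoS₂]) hA0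
        hresS₂ (fun e he hef => (hledS₂ e he hef).symm) hisoC₁ (by rw [hoC₁]) he3C₁ hrC₁' hdivC₁
      refine ⟨h1, fun e he hef => (h2 e he hef).symm, ?_⟩
      rw [show Finsupp.single la 1 + Finsupp.single κ 1 + Finsupp.single u 3 =
        (Finsupp.single κ 1 + Finsupp.single la 1 + Finsupp.single u 3 : Fin 4 →₀ ℕ) by rw [add_comm (Finsupp.single la 1)]]
      exact h4
  obtain ⟨hresC₁, hledC₁, hVC₁⟩ := hentry
  have hrdegC₁ : C₁.r.degree = 2 := by rw [hrC₁, map_add, Finsupp.degree_single, Finsupp.degree_single]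
  have hrfC₁ : C₁.r f = 0 := by
    rw [hrC₁, Finsupp.add_apply, Finsupp.single_eq_of_ne hlf.symm, Finsupp.single_eq_of_ne hmf.symm, add_zero]
  have hruC₁ : C₁.r u = 0 := by
    rw [hrC₁, Finsupp.add_apply, Finsupp.single_eq_of_ne hlu.symm, Finsupp.single_eq_of_ne hmu.symm, add_zero]
  have hstrC₁ := straight_readings_of_resForm hoC₁ hrdegC₁ hresC₁
  -- (5) the second Tschirnhaus at `C₁`
  obtain ⟨ψ, hψ0, hψu, hψf, hψsupp, hrowψ, hVψ, -⟩ := exists_second_tschirnhaus (K := K) hlm hlu.symm hmu.symm hlf.symm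
    hmf.symm huf.symm (G := C₁.F.divMonomial C₁.r) (M := N + 6) three_ne_zero_five (by omega)
    (fun n hnf hnM hn => by
      rw [coeff_divMonomial]
      by_contra hne
      have hmem := mem_support_iff.mpr hne
      have h := hledC₁ _ hmem (by rw [Finsupp.add_apply, hnf, add_zero, hrfC₁]; exact Nat.zero_le 3)
      rw [hrC₁] at h
      simp only [Finsupp.add_apply, Finsupp.single_eq_same, Finsupp.single_eq_of_ne hlm,
        Finsupp.single_eq_of_ne (Ne.symm hlm), add_zero, zero_add] at h
      obtain ⟨h1, h2⟩ := h
      rcases hn with h0 | h0 <;> omega)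
    (by rw [coeff_divMonomial]; exact hVC₁)
    (by
      rw [coeff_divMonomial]
      refine hstrC₁.2 _ (by simp [map_add, Finsupp.degree_single]) fun h => ?_
      have h' := DFunLike.congr_fun h u
      rw [Finsupp.add_apply, Finsupp.add_apply, Finsupp.single_eq_of_ne hlu.symm, Finsupp.single_eq_of_ne hmu.symm,
        Finsupp.single_eq_same, Finsupp.single_eq_of_ne huf] at h'
      omega)
    N
  -- (6) the virtual state and the substitution
  have hG : C₁.F = monomial C₁.r 1 * C₁.F.divMonomial C₁.r := (monomial_mul_divMonomial hdivC₁).symm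
  refine ⟨⟨deletePthPowers 5 (tsch u ψ C₁.F), C₁.r, C₁.exc⟩, fun i => tsch u ψ (tsch f Φp (X i)),
    ?_, ?_, ?_, ?_, ?_, ?_, ?_, hrC₁, ?_, ⟨_, hA0, ?_⟩, ?_, ?_, ?_, ?_, ?_⟩
  · dsimp only
    rw [tsch_X_of_ne _ hlf, tsch_X_of_ne _ hlu]
  · dsimp only
    rw [tsch_X_of_ne _ hmf, tsch_X_of_ne _ hmu]
  · dsimp only
    rw [tsch_X_of_ne _ huf, tsch_X_self, map_add, constantCoeff_X, zero_add, hψ0]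
  · dsimp only
    rw [tsch_X_self, map_add, tsch_X_of_ne _ huf.symm, map_add, constantCoeff_X, zero_add, constantCoeff_tsch hψ0,
      hΦp0]
  · -- the free tangent block is unipotent
    have hψu1 : coeff (Finsupp.single u 1) ψ = 0 := by
      by_contra h
      have := (hψsupp _ (mem_support_iff.mpr h)).1
      rw [Finsupp.single_eq_same] at this
      exact one_ne_zero this
    have hψf1 : coeff (Finsupp.single f 1) ψ = 0 := by
      by_contra h
      have := (hψsupp _ (mem_support_iff.mpr h)).2.1
      rw [Finsupp.single_eq_same] at this
      exact one_ne_zero this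
    have hΦpf1 : coeff (Finsupp.single f 1) (tsch u ψ Φp) = 0 := by
      by_contra h
      obtain ⟨b, hb, hbf, -⟩ := exists_of_mem_support_tsch huf hψ0 hψf Φp (mem_support_iff.mpr h)
      rw [Finsupp.single_eq_same] at hbf
      have := (FrameChange.not_mem_vars_iff f Φp).mp hΦpvars b hb
      omega
    have hfu : coeff (Finsupp.single f 1) (X u : MvPolynomial (Fin 4) K) = 0 := by
      rw [coeff_X, if_neg]
      intro h
      have := DFunLike.congr_fun h f
      rw [Finsupp.single_eq_same, Finsupp.single_eq_of_ne huf.symm] at this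
      omega
    have huf' : coeff (Finsupp.single u 1) (X f : MvPolynomial (Fin 4) K) = 0 := by
      rw [coeff_X, if_neg]
      intro h
      have := DFunLike.congr_fun h u
      rw [Finsupp.single_eq_same, Finsupp.single_eq_of_ne huf] at this
      omega
    dsimp only
    rw [tsch_X_of_ne _ huf, tsch_X_self, tsch_X_self, map_add, tsch_X_of_ne _ huf.symm, coeff_add, coeff_add, coeff_add,
      coeff_add, coeff_X_same, coeff_X_same, hfu, huf', hψu1, hψf1, hΦpf1]
    norm_num
  · -- the relation: cleaning commutes with the substitutions
    show deletePthPowers 5 (tsch u ψ C₁.F) = deletePthPowers 5 (aeval (fun i => tsch u ψ (tsch f Φp (X i))) A.F)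
    have hcomp : (aeval (fun i => tsch u ψ (tsch f Φp (X i))) : MvPolynomial (Fin 4) K →ₐ[K] MvPolynomial (Fin 4) K) =
        (tsch u ψ).comp (tsch f Φp) := MvPolynomial.algHom_ext fun i => by rw [aeval_X, AlgHom.comp_apply]
    rw [hcomp, AlgHom.comp_apply, hC₁F, FrameChange.tsch, FrameChange.tsch,
      SwapTransport.deletePthPowers_aeval_deletePthPowers 5]
  · rw [ordZero_clean_tsch 5 hψu hψ0 (by rw [hC₁F]; exact PointBlowup.deletePthPowers_deletePthPowers 5 _)]; exact hoC₁
  · exact forall_le_of_mem_support_clean_tsch 5 hruC₁ hdivC₁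
  · rw [resForm_cleanTschState_eq 5 hψu hψ0 (by rw [hoC₁]) h56,
      resForm_tschState_eq_tsch_linearPart hψu hψ0 hruC₁ hdivC₁, hresC₁, map_mul, FrameChange.tsch_C, map_pow,
      tsch_X_of_ne _ huf.symm]
  · intro e he hef
    exact lowLedger_deletePthPowers 5 (lowLedger_tsch_of_ne hlu.symm hmu.symm huf ψ (d := 4) (ra := 2) (ra' := 2)
      (fun e he hef => hledC₁ e he (by omega))) e he (by omega)
  · intro d hd hdN
    rw [hG, tsch_monomial_mul ψ hruC₁] at hd
    have hd' := mem_support_of_mem_support_deletePthPowers 5 hd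
    exact uRow_support_of_coeff hruC₁ hrfC₁ (B := N)
      (fun m h1 h2 h3 => hrowψ m h1 h2 (by omega) (by omega)) hd' (by rw [hrdegC₁]; omega)
  · show coeff (C₁.r + _) (deletePthPowers 5 (tsch u ψ C₁.F)) ≠ 0
    rw [hG, tsch_monomial_mul ψ hruC₁, coeff_deletePthPowers, if_neg, coeff_monomial_mul',
      if_pos le_self_add, add_tsub_cancel_left, one_mul, hVψ, coeff_divMonomial]
    · exact hVC₁
    · refine not_isPthPowerExponent_of_not_dvd (i := u) ?_
      rw [Finsupp.add_apply, hruC₁, zero_add, Finsupp.add_apply, Finsupp.add_apply, Finsupp.single_eq_of_ne hlu.symm,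
        Finsupp.single_eq_of_ne hmu.symm, Finsupp.single_eq_same]
      decide
  · exact (isIsolated_clean_tsch_iff 5 hψu hψ0 _).mpr hisoC₁
  · exact (finrank_resVertex_cleanTschState 5 hψu hψ0 hruC₁ hdivC₁ hoC₁ h56).trans he3C₁

/-- **THE C∞ VIRTUAL ENTRY in the virtual window's own currency** (res-dim4-typ-1 g3's `hE` /
`virtual_window_false_at (hrel0) (hfr0)`, bijection `π₀ = id`): for every precision `M` and every jet `N` a framed virtual
state `B₀` with an `ℛ²`-relation `B₀.F = clean (U⁵·(aeval θ) A.F) + E` (`U = 1`, `E = 0 ∈ 𝔪₀ᴹ`, slot units `e = 1`) and the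
frame at jet `N`.  Same hypotheses as `exists_cInf_virtual_entry`. [OURS] [cite: CossartJannsenSaito2020, Thm. 3.14] -/
theorem exists_cInf_virtual_entry_rel {la mu u f : Fin 4} (hlm : la ≠ mu) (hlu : la ≠ u) (hlf : la ≠ f) (hmu : mu ≠ u)
    (hmf : mu ≠ f) (huf : u ≠ f) {κ : Fin 4} (hκ : κ = la ∨ κ = mu) {A' A : State K} {β : Fin 4 → K}
    (hβκ : β κ = 0) (hβla : β la = 0) (hβmu : β mu = 0) (hA : A = CentreBlowup.step 5 Finset.univ κ β A')
    (hrA' : A'.r = Finsupp.single la 1 + Finsupp.single mu 1) (hrA : A.r = Finsupp.single la 1 + Finsupp.single mu 1)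
    (hdivA' : ∀ e ∈ A'.F.support, A'.r ≤ e) (hdivA : ∀ e ∈ A.F.support, A.r ≤ e) (hoA' : ordZero A'.F = (6 : ℕ))
    (hoA : ordZero A.F = (6 : ℕ)) (hcleanA' : deletePthPowers 5 A'.F = A'.F) (hisoA : IsIsolated 5 A.F)
    (he3A : Module.finrank K (resVertex A) = 3) {ℓ : Fin 4 → K} {a0 : K}
    (hform' : resForm A' = C a0 * (∑ i, C (ℓ i) * X i) ^ 4) (hℓf : ℓ f ≠ 0) {U S T : MvPolynomial (Fin 4) K}
    (hU : MvPolynomial.eval (0 : Fin 4 → K) U ≠ 0)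
    (hledger : U * (A'.F.divMonomial A'.r) = S * (X la * X mu) + T * (∑ i, C (ℓ i) * X i) ^ 4) :
    ∀ M N : ℕ, ∃ B₀ : State K,
      (∃ (θ e : Fin 4 → MvPolynomial (Fin 4) K) (U E : MvPolynomial (Fin 4) K),
        θ la = X la * e la ∧ θ mu = X mu * e mu ∧ constantCoeff (e la) ≠ 0 ∧ constantCoeff (e mu) ≠ 0 ∧
        constantCoeff (θ u) = 0 ∧ constantCoeff (θ f) = 0 ∧
        coeff (Finsupp.single u 1) (θ u) * coeff (Finsupp.single f 1) (θ f) -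
          coeff (Finsupp.single f 1) (θ u) * coeff (Finsupp.single u 1) (θ f) ≠ 0 ∧
        constantCoeff U ≠ 0 ∧ E ∈ originIdeal K ^ M ∧ B₀.F = deletePthPowers 5 (U ^ 5 * aeval θ A.F) + E) ∧
      ordZero B₀.F = 6 ∧ B₀.r = Finsupp.single la 1 + Finsupp.single mu 1 ∧ (∀ d ∈ B₀.F.support, B₀.r ≤ d) ∧
      (∃ a : K, a ≠ 0 ∧ resForm B₀ = C a * X f ^ 4) ∧
      (∀ e ∈ B₀.F.support, e f ≤ 3 → 2 ≤ e la ∧ 2 ≤ e mu) ∧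
      (∀ d ∈ B₀.F.support, d.degree < N → ¬ (d u = 2 ∧ d f = 0)) ∧
      coeff (B₀.r + (Finsupp.single la 1 + Finsupp.single mu 1 + Finsupp.single u 3)) B₀.F ≠ 0 ∧
      IsIsolated 5 B₀.F ∧ Module.finrank K (resVertex B₀) = 3 := by
  intro M N
  obtain ⟨B, θ, h1, h2, h3, h4, h5, h6, h7, h8, h9, h10, h11, h12, h13, h14, h15⟩ :=
    exists_cInf_virtual_entry hlm hlu hlf hmu hmf huf hκ hβκ hβla hβmu hA hrA' hrA hdivA' hdivA hoA' hoA hcleanA' hisoA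
      he3A hform' hℓf hU hledger N
  refine ⟨B, ⟨θ, fun _ => 1, 1, 0, by rw [h1, mul_one], by rw [h2, mul_one], by rw [map_one]; exact one_ne_zero,
    by rw [map_one]; exact one_ne_zero, h3, h4, h5, by rw [map_one]; exact one_ne_zero, Submodule.zero_mem _,
    by rw [one_pow, one_mul, add_zero]; exact h6⟩, by rw [h7]; rfl, h8, h9, h10, h11, h12, h13, h14, h15⟩

end Entry

end ResCone

end Summit.ResolutionOfSingularities.ResolutionOfSingularities.Theorems.PIDim4

end
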